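import Literature.AlgebraicGeometry.AbelianSchemes.AbelianVarietyCechProductMaps
import Literature.AlgebraicGeometry.Modules.PullbackSectionsBaseChange
import HarnessLib

/-!
# The shear square of a group scheme: `(p₁, m) : A × A ⥲ A × A`, hence `IsPullback p₁ m (A → S) (A → S)`, and the
# shear cover `W″ (i, l) = p₁⁻¹U_i ∩ m⁻¹U_l` of `A × A` (Mumford, *Abelian Varieties*, §8 (vii); SGA 3 I, Exp. I 2.3)

Layer `Literature/AlgebraicGeometry/AbelianSchemes`; namespaces `Literature.AlgebraicGeometry.AbelianSchemes.GrpObjShear` (§1, any cartesian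
monoidal category), `Literature.AlgebraicGeometry.AbelianSchemes.AbelianSchemeOver` (§2) and
`Literature.AlgebraicGeometry.AbelianSchemes.AbelianVarietyCech` (§3, the F-J3b setting of ★ `AbelianVarietyCechProductMaps`).  PROOF file
(theorems only; no definition, no named fact, no instance, no notation, no `sorry`).  Cell `hodgecm-mathlib` (D-0151), pay-down programme
«H1-DIM in char `p`» (F0P6 RULING «M-25» (2)), file **(S)** of the D1 road «`H^i(A, M) = 0` for `M ∈ Pic⁰ ∖ 0`» ([MumfordAV1970] §8 (vii)):
the SECOND cartesian structure `(p₁, m)` on `A × A`, along which Künneth (★ (K) `Modules/CechProductCoverKunnethBoxTensor`) reads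
`p₁^*E ⊗ m^*F`.

* §1 (`G` a group object of a cartesian monoidal category): the shear morphism `(p₁, m) = lift fst μ : G ⊗ G ⟶ G ⊗ G` and
  `(p₁, p₁⁻¹·p₂) = lift fst (lift (fst ≫ ι) snd ≫ μ)` are mutually inverse (`lift_fst_mul_comp_lift_fst_invMul`,
  `lift_fst_invMul_comp_lift_fst_mul`); **`isIso_lift_fst_mul`**;
* §2 (`X : Over S` a group object, e.g. `A.X` for an abelian scheme): **`isPullback_fst_left_mul_left : IsPullback p₁ m (X → S) (X → S)`**
  on underlying schemes (the chosen square `IsPullback p₁ p₂` transported along the shear isomorphism, Mathlib `IsPullback.of_iso'`);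
* §3 (an abelian variety `A` over a field `k`, a finite affine cover `U`, the product cover `W₀` and the triple cover `W ((i,j),l) = W₀(i,j) ∩ m⁻¹U_l`
  of the F-J3b files as BINDERS): **`exists_shearCover`** — affine opens `W″ (i, l) = p₁⁻¹U_i ∩ m⁻¹U_l` (affine by ★
  `isAffineOpen_of_isPullback_of_eq_inf` on the square of §2 over the affine base); `shearCover_eq`; the Leray hypothesis `hW″a` (★
  `isAffineOpen_cechOpen_of_nonempty`, `A × A` separated); the refinement inequalities `refinedCover_le_shearCover`
  (`W ((i,j),l) ≤ W″ (i,l)`) and `refinedCover_le_productCover'` (`W ((i,j),l) ≤ W₀ (i,j)`, ★ without the `𝟙⁻¹`); and `hW″cov` (it covers,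
  since the triple cover does, ★ `hWcov`).  So `W` is a COMMON REFINEMENT of `W₀` and `W″` — the input of ★ (C)
  `Modules/ModuleCechRefinementTransport`.

HC_CM is proved only modulo the 7 printed citations until rung 0 closes — nothing here bears on a summit statement.

## References
* [MumfordAV1970] D. Mumford, *Abelian Varieties* (1970), §8 (vii) (p. 76) (Künneth on `X × X` along `m`).
* [SGA3I] M. Demazure, A. Grothendieck, *SGA 3, Tome I*, LNM 151, Exp. I §2.3 (group objects; translations are automorphisms).
* [GortzWedhorn2020] U. Görtz, T. Wedhorn, *Algebraic Geometry I*, 2nd ed. (2020), Prop. 4.16 and Prop. 4.20 (fibre products of affine schemes).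
* [StacksProject] The Stacks Project, Tag 01JO (fibre products of affines), Tag 01FG (Čech complexes and refinements).
* [Hartshorne1977] R. Hartshorne, *Algebraic Geometry* (1977), III §4 (pp. 218–222).
-/

noncomputable section

universe v u

open CategoryTheory CategoryTheory.Limits CategoryTheory.MonoidalCategory CartesianMonoidalCategory AlgebraicGeometry
  TopologicalSpace Opposite
open scoped MonObj CategoryTheory.Obj

/-! ## §1 The shear isomorphism of a group object -/

namespace Literature.AlgebraicGeometry.AbelianSchemes.GrpObjShear

variable {C : Type u} [Category.{v} C] [CartesianMonoidalCategory C] (G : C) [GrpObj G]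

/-- `(x, y) ↦ (x, xy)` followed by `(x, z) ↦ (x, x⁻¹z)` is the identity: `lift fst μ ≫ lift fst (lift (fst ≫ ι) snd ≫ μ) = 𝟙`.
[cite: SGA3I, Exp. I §2.3] -/
theorem lift_fst_mul_comp_lift_fst_invMul :
    lift (fst G G) μ[G] ≫ lift (fst G G) (lift (fst G G ≫ ι[G]) (snd G G) ≫ μ[G]) = 𝟙 (G ⊗ G) := by
  refine CartesianMonoidalCategory.hom_ext _ _ ?_ ?_
  · rw [Category.assoc, lift_fst, lift_fst, Category.id_comp]
  · rw [Category.assoc, lift_snd, comp_lift_assoc, Category.id_comp, lift_snd, ← Category.assoc, lift_fst]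
    -- `lift (fst ≫ ι) μ ≫ μ = snd`
    rw [GrpObj.lift_inv_left_eq, lift_fst_snd, Category.id_comp]

/-- `(x, z) ↦ (x, x⁻¹z)` followed by `(x, y) ↦ (x, xy)` is the identity: `lift fst (lift (fst ≫ ι) snd ≫ μ) ≫ lift fst μ = 𝟙`.
[cite: SGA3I, Exp. I §2.3] -/
theorem lift_fst_invMul_comp_lift_fst_mul :
    lift (fst G G) (lift (fst G G ≫ ι[G]) (snd G G) ≫ μ[G]) ≫ lift (fst G G) μ[G] = 𝟙 (G ⊗ G) := by
  refine CartesianMonoidalCategory.hom_ext _ _ ?_ ?_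
  · rw [Category.assoc, lift_fst, lift_fst, Category.id_comp]
  · rw [Category.assoc, lift_snd, Category.id_comp]
    -- `lift fst (lift (fst ≫ ι) snd ≫ μ) ≫ μ = snd`
    exact (GrpObj.eq_lift_inv_left (lift (fst G G ≫ ι[G]) (snd G G) ≫ μ[G]) (fst G G) (snd G G)).1 rfl

/-- **The shear morphism `(p₁, m) = lift fst μ : G × G ⟶ G × G` of a group object is an isomorphism.** [cite: SGA3I, Exp. I §2.3] -/
theorem isIso_lift_fst_mul : IsIso (lift (fst G G) μ[G]) :=
  ⟨lift (fst G G) (lift (fst G G ≫ ι[G]) (snd G G) ≫ μ[G]), lift_fst_mul_comp_lift_fst_invMul G,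
    lift_fst_invMul_comp_lift_fst_mul G⟩

end Literature.AlgebraicGeometry.AbelianSchemes.GrpObjShear

/-! ## §2 The shear square of a group scheme over `S` is cartesian on underlying schemes -/

namespace Literature.AlgebraicGeometry.AbelianSchemes.AbelianSchemeOver

variable {S : Scheme.{u}} (X : Over S) [GrpObj X]

/-- **`IsPullback p₁ m (X → S) (X → S)`**: for a group object `X` of `Over S`, the underlying square of schemes with legs the first
projection and the group law `X ×_S X ⇉ X` over `X → S` is cartesian (the chosen fibre-product square transported along the shear
isomorphism `(p₁, m)` of §1). [cite: SGA3I, Exp. I §2.3] [cite: MumfordAV1970, §8 (vii) (p. 76)] -/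
theorem isPullback_fst_left_mul_left : IsPullback (fst X X).left μ[X].left X.hom X.hom := by
  have H0 : IsPullback (fst X X).left (snd X X).left X.hom X.hom := IsPullback.of_hasPullback X.hom X.hom
  haveI := GrpObjShear.isIso_lift_fst_mul X
  let e : X ⊗ X ≅ X ⊗ X := asIso (lift (fst X X) μ[X])
  refine H0.of_iso' ((Over.forget S).mapIso e) (Iso.refl _) (Iso.refl _) (Iso.refl _) ?_ ?_ (by simp) (by simp)
  · change (lift (fst X X) μ[X]).left ≫ (fst X X).left = (fst X X).left ≫ 𝟙 _
    rw [← Over.comp_left, lift_fst, Category.comp_id]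
  · change (lift (fst X X) μ[X]).left ≫ (snd X X).left = μ[X].left ≫ 𝟙 _
    rw [← Over.comp_left, lift_snd, Category.comp_id]

end Literature.AlgebraicGeometry.AbelianSchemes.AbelianSchemeOver

/-! ## §3 The shear cover `W″ (i, l) = p₁⁻¹U_i ∩ m⁻¹U_l` of `A × A` (F-J3b setting) -/

namespace Literature.AlgebraicGeometry.AbelianSchemes.AbelianVarietyCech

open Literature.AlgebraicGeometry.Modules Literature.AlgebraicGeometry.Morphisms

variable {k : Type} [Field k] (A : AbelianSchemeOver (Spec (.of k)))
  {I : Type} [LinearOrder I] [Fintype I] (U : I → A.X.left.affineOpens) (hcov : ⨆ i, (U i).1 = ⊤)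
  (W₀ : I ×ₗ I → (X2 A).affineOpens)
  (hW₀ : ∀ i j, (W₀ (toLex (i, j))).1 = p₁ A ⁻¹ᵁ (U i).1 ⊓ p₂ A ⁻¹ᵁ (U j).1)
  (W : (I ×ₗ I) ×ₗ I → (X2 A).affineOpens)
  (hW : ∀ c l, (W (toLex (c, l))).1 = (W₀ c).1 ⊓ m A ⁻¹ᵁ (U l).1)

omit [LinearOrder I] [Fintype I] in
/-- **`IsPullback p₁ m (A → Spec k) (A → Spec k)`** for an abelian variety (§2 for `A.X`). [cite: MumfordAV1970, §8 (vii) (p. 76)] -/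
theorem isPullback_p₁_m : IsPullback (p₁ A) (m A) A.X.hom A.X.hom :=
  AbelianSchemeOver.isPullback_fst_left_mul_left A.X

omit [LinearOrder I] [Fintype I] in
/-- `p₁⁻¹U_i ∩ m⁻¹U_l` is affine (it is `U_i ×_k U_l` for the shear square, ★ `isAffineOpen_of_isPullback_of_eq_inf`).
[cite: GortzWedhorn2020, Prop. 4.16 and Prop. 4.20] [cite: StacksProject, Tag 01JO] -/
theorem isAffineOpen_preimage_p₁_inf_preimage_m (i l : I) : IsAffineOpen (p₁ A ⁻¹ᵁ (U i).1 ⊓ m A ⁻¹ᵁ (U l).1) :=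
  isAffineOpen_of_isPullback_of_eq_inf (US := ⊤) (isPullback_p₁_m A) (isAffineOpen_top (Spec (.of k))) (U l).2 (U i).2
    le_top le_top rfl

omit [LinearOrder I] [Fintype I] in
/-- **THE SHEAR COVER exists**: affine opens `W″ (i, l) = p₁⁻¹U_i ∩ m⁻¹U_l` of `A × A` indexed by `I ×ₗ I` (characterised, not constructed:
consumers `obtain` it once — the product-cover BINDER of ★ (K) for the square `(p₁, m)`). [cite: MumfordAV1970, §8 (vii) (p. 76)]
[cite: StacksProject, Tag 01JO] -/
theorem exists_shearCover :
    ∃ W'' : I ×ₗ I → (X2 A).affineOpens, ∀ i l, (W'' (toLex (i, l))).1 = p₁ A ⁻¹ᵁ (U i).1 ⊓ m A ⁻¹ᵁ (U l).1 :=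
  ⟨fun c => ⟨_, isAffineOpen_preimage_p₁_inf_preimage_m A U (ofLex c).1 (ofLex c).2⟩, fun _ _ => rfl⟩

variable (W'' : I ×ₗ I → (X2 A).affineOpens) (hW'' : ∀ i l, (W'' (toLex (i, l))).1 = p₁ A ⁻¹ᵁ (U i).1 ⊓ m A ⁻¹ᵁ (U l).1)

omit [LinearOrder I] [Fintype I] in
include hW'' in
/-- The shear cover read on a general index. [cite: StacksProject, Tag 01FG] -/
theorem shearCover_eq (c : I ×ₗ I) : (W'' c).1 = p₁ A ⁻¹ᵁ (U (ofLex c).1).1 ⊓ m A ⁻¹ᵁ (U (ofLex c).2).1 := by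
  rw [← hW'']
  rfl

omit [LinearOrder I] [Fintype I] in
/-- Finite non-empty intersections of `W″` are affine (`A × A` is separated). [cite: GortzWedhorn2023, Thm. 22.9 (p. 236)]
[cite: Hartshorne1977, III §4 (pp. 218–222)] -/
theorem hW''a : ∀ s : Finset (I ×ₗ I), s.Nonempty → IsAffineOpen (cechOpen (fun c => (W'' c).1) s) := fun s hs => by
  haveI := isSeparated_X2 A
  exact isAffineOpen_cechOpen_of_nonempty W'' hs

omit [LinearOrder I] [Fintype I] in
include hW hW'' hW₀ in
/-- **The triple cover refines the shear cover**: `W ((i,j),l) ≤ W″ (i,l)` (index map `((i,j),l) ↦ (i,l)`).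
[cite: StacksProject, Tag 01FG] [cite: Hartshorne1977, III §4 (p. 218)] -/
theorem refinedCover_le_shearCover (d : (I ×ₗ I) ×ₗ I) :
    (W d).1 ≤ (W'' (toLex ((ofLex (ofLex d).1).1, (ofLex d).2))).1 := by
  rw [hW'', tripleCover_eq W₀ (m A) U W hW d, productCover_eq W₀ hW₀ (ofLex d).1]
  exact inf_le_inf_right _ inf_le_left

omit [LinearOrder I] [Fintype I] in
include hW in
/-- **The triple cover refines the product cover**: `W ((i,j),l) ≤ W₀ (i,j)` (index map `((i,j),l) ↦ (i,j)`; ★ `refinedCover_le_productCover`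
without the `𝟙⁻¹`). [cite: StacksProject, Tag 01FG] [cite: Hartshorne1977, III §4 (p. 218)] -/
theorem refinedCover_le_productCover' (d : (I ×ₗ I) ×ₗ I) : (W d).1 ≤ (W₀ (ofLex d).1).1 := by
  rw [tripleCover_eq W₀ (m A) U W hW d]
  exact inf_le_left

omit [LinearOrder I] [Fintype I] in
include hcov hW₀ hW hW'' in
/-- **The shear cover COVERS `A × A`** (its refinement, the triple cover, does: ★ `hWcov`). [cite: StacksProject, Tag 01FG] -/
theorem hW''cov : ⨆ c, (W'' c).1 = ⊤ := by
  refine top_le_iff.mp ?_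
  rw [← hWcov A U hcov W₀ hW₀ W hW]
  exact iSup_le fun d => (refinedCover_le_shearCover A U W₀ hW₀ W hW W'' hW'' d).trans
    (le_iSup (fun c => (W'' c).1) (toLex ((ofLex (ofLex d).1).1, (ofLex d).2)))

end Literature.AlgebraicGeometry.AbelianSchemes.AbelianVarietyCech

end
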